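import Literature.Analysis.Complex.SymmetricRiemannMap

/-!
# Symmetric charts of a domain in `ℍ` with a free boundary segment (extended exports)

Helper file for route CardyAnchoredRigidity, item stmt-CriticalPhenomena-14488
(`StretchedPullbackNotTargetBlind`).

This is the tree's `Complex.exists_bijOn_halfDisc` (`Literature.Analysis.Complex.SymmetricRiemannMap`)
with more of its construction exported. Let `U ⊆ ℍ` be open and connected with the square-root
property, containing the half-disc `B(x, r) ∩ ℍ` above a real point `x`. The symmetric Riemann map
`F` of the conjugation-symmetric domain `E = (U ∪ B(x,r)) ∪ conj (U ∪ B(x,r))` based at `x`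
(`Complex.exists_bijOn_ball_symmetric`) is a holomorphic bijection `E → 𝔻` with holomorphic inverse,
restricting to a bijection `U → 𝔻⁺ = 𝔻 ∩ ℍ`; it is REAL on the free segment `(x - r, x + r)`,
STRICTLY INCREASING there, with `F x = 0` and `F'(x) > 0`. Compared with the tree's statement we
also export the symmetric domain `E ⊇ U ∪ B(x, r)` on which `F` is holomorphic (so that `F` is
continuous, indeed holomorphic, ACROSS the free segment) and the behaviour on the real segment.
The proof is the tree's, verbatim up to the final packaging (adapted from
`Literature/Analysis/Complex/SymmetricRiemannMap.lean`).
-/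

noncomputable section

open Filter Metric Set Topology Function
open scoped ComplexConjugate
open UpperHalfPlane (upperHalfPlaneSet isOpen_upperHalfPlaneSet)

namespace Summit.CriticalPhenomena.CardyFormulaZ2.Theorems.StretchedPullback

open Complex

variable {U : Set ℂ}

/-- **Symmetric chart with a free boundary segment.** For `U ⊆ ℍ` open, connected, with the
square-root property and containing `B(x, r) ∩ ℍ` (`x` real, `r > 0`), there are an open set
`E ⊇ U ∪ B(x, r)` and a map `F`, holomorphic on `E`, bijective from `E` onto the unit disc with
holomorphic inverse and from `U` onto the upper half-disc, real and strictly increasing on the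
real segment `(x - r, x + r)`, with `F x = 0` and `F' x > 0`. (Tree: `Complex.exists_bijOn_halfDisc`,
whose proof this repeats with more exports.) -/
theorem exists_symmetricChart (hU : IsOpen U) (hUc : IsPreconnected U) (hsq : HasSqrt U)
    (hUH : U ⊆ upperHalfPlaneSet) {x r : ℝ} (hr : 0 < r)
    (hB : ball (x : ℂ) r ∩ upperHalfPlaneSet ⊆ U) :
    ∃ (E : Set ℂ) (F : ℂ → ℂ), IsOpen E ∧ U ⊆ E ∧ ball (x : ℂ) r ⊆ E ∧
      DifferentiableOn ℂ F E ∧ BijOn F E (ball 0 1) ∧ BijOn F U (ball 0 1 ∩ upperHalfPlaneSet) ∧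
      DifferentiableOn ℂ (invFunOn F E) (ball 0 1) ∧
      EqOn (invFunOn F U) (invFunOn F E) (ball 0 1 ∩ upperHalfPlaneSet) ∧
      DifferentiableOn ℂ (invFunOn F U) (ball 0 1 ∩ upperHalfPlaneSet) ∧
      F x = 0 ∧ (∃ c : ℝ, 0 < c ∧ HasDerivAt F c x) ∧
      (∀ t : ℝ, (t : ℂ) ∈ ball (x : ℂ) r → (F t).im = 0) ∧
      StrictMonoOn (fun t : ℝ => (F t).re) (Ioo (x - r) (x + r)) := by
  set B : Set ℂ := ball (x : ℂ) r with hB_def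
  set V₁ : Set ℂ := U ∪ B with hV₁
  set V₂ : Set ℂ := conj ⁻¹' V₁ with hV₂
  set E : Set ℂ := V₁ ∪ V₂ with hE_def
  have hBc : conj ⁻¹' B = B := conj_preimage_ball_ofReal x r
  have hxB : (x : ℂ) ∈ B := mem_ball_self hr
  have hV₁o : IsOpen V₁ := hU.union isOpen_ball
  have hV₂o : IsOpen V₂ := continuous_conj.isOpen_preimage _ hV₁o
  have hEo : IsOpen E := hV₁o.union hV₂o
  have hUB : U ∩ B = B ∩ upperHalfPlaneSet := by
    apply Subset.antisymm
    · rintro z ⟨hzU, hzB⟩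
      exact ⟨hzB, hUH hzU⟩
    · rintro z ⟨hzB, hzH⟩
      exact ⟨hB ⟨hzB, hzH⟩, hzB⟩
  -- the square-root property of `E`, by gluing
  have hsqV₁ : HasSqrt V₁ :=
    hsq.union ((convex_ball _ _).hasSqrt isOpen_ball ⟨_, hxB⟩) hU isOpen_ball (by
      rw [hUB]; exact ((convex_ball _ _).inter (convex_halfSpace_im_gt 0)).isPreconnected)
  have hsqV₂ : HasSqrt V₂ := hsqV₁.conj_preimage hV₁o
  have hV₁₂ : V₁ ∩ V₂ = B := by
    apply Subset.antisymm
    · rintro z ⟨hz₁, hz₂⟩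
      by_contra hzB
      have hzU : z ∈ U := hz₁.resolve_right hzB
      have hz₂' : conj z ∈ U := by
        rcases hz₂ with h | h
        · exact h
        · exact absurd (show z ∈ B by rwa [← hBc]) hzB
      have h1 : 0 < z.im := hUH hzU
      have h2 : 0 < (conj z).im := hUH hz₂'
      rw [conj_im] at h2
      linarith
    · intro z hz
      exact ⟨Or.inr hz, show conj z ∈ V₁ from Or.inr (by rw [← hBc] at hz; exact hz)⟩
  have hsqE : HasSqrt E := hsqV₁.union hsqV₂ hV₁o hV₂o (by
    rw [hV₁₂]; exact (convex_ball _ _).isPreconnected)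
  -- connectedness, symmetry, properness of `E`
  have hpU : (x : ℂ) + (r / 2 : ℝ) * I ∈ B ∩ upperHalfPlaneSet := by
    constructor
    · rw [hB_def, Metric.mem_ball, dist_eq_norm, add_sub_cancel_left, norm_mul, norm_real, norm_I,
        mul_one, Real.norm_eq_abs, abs_of_pos (by positivity)]
      linarith
    · show 0 < ((x : ℂ) + (r / 2 : ℝ) * I).im
      simp [hr]
  have hV₁c : IsPreconnected V₁ :=
    hUc.union' ⟨_, hB hpU, hpU.1⟩ (convex_ball _ _).isPreconnected
  have hV₂eq : V₂ = conj '' V₁ := by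
    rw [hV₂, image_eq_preimage_of_inverse (f := (conj : ℂ → ℂ)) (g := (conj : ℂ → ℂ))
      conj_conj conj_conj]
  have hV₂c : IsPreconnected V₂ := by
    rw [hV₂eq]
    exact hV₁c.image _ continuous_conj.continuousOn
  have hxV₁ : (x : ℂ) ∈ V₁ := Or.inr hxB
  have hxV₂ : (x : ℂ) ∈ V₂ := show conj (x : ℂ) ∈ V₁ by rwa [conj_ofReal]
  have hEc : IsPreconnected E := hV₁c.union _ hxV₁ hxV₂ hV₂c
  have hxE : (x : ℂ) ∈ E := Or.inl hxV₁
  have hsymm : MapsTo conj E E := by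
    rintro z (hz | hz)
    · exact Or.inr (show conj (conj z) ∈ V₁ by rwa [conj_conj])
    · exact Or.inl hz
  have hV₁real : ∀ z ∈ V₁, z.im = 0 → z ∈ B := by
    rintro z (hz | hz) hzim
    · exact absurd hzim (hUH hz).ne'
    · exact hz
  have hE' : E ≠ univ := by
    intro h
    have hmem : ((x + r : ℝ) : ℂ) ∈ E := h ▸ mem_univ _
    have hnotB : ((x + r : ℝ) : ℂ) ∉ B := by
      rw [hB_def, Metric.mem_ball, dist_eq_norm, ← ofReal_sub, norm_real, Real.norm_eq_abs]
      simp [abs_of_pos hr]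
    rcases hmem with hz | hz
    · exact hnotB (hV₁real _ hz (ofReal_im _))
    · have hz' : ((x + r : ℝ) : ℂ) ∈ V₁ := by
        have := hz
        rwa [hV₂, mem_preimage, conj_ofReal] at this
      exact hnotB (hV₁real _ hz' (ofReal_im _))
  -- the symmetric Riemann map of `E` based at `x`
  obtain ⟨F, hF, hbij, hF0, hF', hFinv, ⟨c, hc, hFd⟩, hFsymm⟩ :=
    exists_bijOn_ball_symmetric hEo hEc hsqE hE' hsymm hxE
  -- `F` is real exactly on the real axis
  have hreal : ∀ z ∈ E, (F z).im = 0 → z.im = 0 := by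
    intro z hz hFz
    have h1 : F (conj z) = F z := by rw [hFsymm z hz, conj_eq_iff_im.2 hFz]
    have h2 : conj z = z := hbij.injOn (hsymm hz) hz h1
    exact conj_eq_iff_im.1 h2
  have hEH : E ∩ upperHalfPlaneSet ⊆ U := by
    rintro z ⟨hzE, hzH⟩
    rcases hzE with (hz | hz) | hz
    · exact hz
    · exact hB ⟨hz, hzH⟩
    · rcases hz with hz | hz
      · have h1 : 0 < (conj z).im := hUH hz
        have h2 : 0 < z.im := hzH
        rw [conj_im] at h1
        exact absurd h2 (by linarith)
      · have hz' : z ∈ B := by rw [← hBc]; exact hz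
        exact hB ⟨hz', hzH⟩
  have hUE : U ⊆ E := fun z hz ↦ Or.inl (Or.inl hz)
  have hBE : B ⊆ E := fun z hz ↦ Or.inl (Or.inr hz)
  have hne : ∀ z ∈ U, (F z).im ≠ 0 := fun z hz h ↦ (hUH hz).ne' (hreal z (hUE hz) h)
  -- the slope of `F` at `x` along a ray: `(F (x + s v) - F x)/(s v) → c`
  have hslope : Tendsto (fun t : ℂ ↦ t⁻¹ • (F (x + t) - F x)) (𝓝[≠] 0) (𝓝 (c : ℂ)) :=
    hFd.tendsto_slope_zero
  -- a witness of positivity just above `x`, from `F'(x) > 0`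
  have hwit : ∃ z ∈ U, 0 < (F z).im := by
    have h2 : Tendsto (fun s : ℝ ↦ (s : ℂ) * I) (𝓝[>] 0) (𝓝[≠] 0) := by
      refine tendsto_nhdsWithin_of_tendsto_nhds_of_eventually_within _ ?_ ?_
      · have : Continuous fun s : ℝ ↦ (s : ℂ) * I := by fun_prop
        simpa using (this.tendsto 0).mono_left nhdsWithin_le_nhds
      · filter_upwards [self_mem_nhdsWithin] with s hs
        exact mul_ne_zero (ofReal_ne_zero.2 (ne_of_gt hs)) I_ne_zero
    have h3 := (continuous_re.tendsto _).comp (hslope.comp h2)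
    simp only [ofReal_re] at h3
    have h4 : ∀ᶠ s : ℝ in 𝓝[>] 0, 0 < (((s : ℂ) * I)⁻¹ • (F (x + (s : ℂ) * I) - F x)).re :=
      h3.eventually (lt_mem_nhds hc)
    have h5 : ∀ᶠ s : ℝ in 𝓝[>] 0, s < r := by
      have : Iio r ∈ 𝓝 (0 : ℝ) := Iio_mem_nhds hr
      exact mem_nhdsWithin_of_mem_nhds this
    obtain ⟨s, ⟨h4s, h5s⟩, hs0⟩ := ((h4.and h5).and self_mem_nhdsWithin).exists
    have hs0' : (0 : ℝ) < s := hs0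
    have hzB : (x : ℂ) + (s : ℂ) * I ∈ B ∩ upperHalfPlaneSet := by
      constructor
      · rw [hB_def, Metric.mem_ball, dist_eq_norm, add_sub_cancel_left, norm_mul, norm_real,
          norm_I, mul_one, Real.norm_eq_abs, abs_of_pos hs0']
        exact h5s
      · show 0 < ((x : ℂ) + (s : ℂ) * I).im
        simp [hs0']
    refine ⟨_, hB hzB, ?_⟩
    rw [hF0, sub_zero, smul_eq_mul] at h4s
    have key : (((s : ℂ) * I)⁻¹ * F (x + (s : ℂ) * I)).re = (F (x + (s : ℂ) * I)).im / s := by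
      rw [mul_inv, Complex.inv_I, mul_re]
      simp [Complex.inv_re, Complex.inv_im, div_eq_inv_mul]
      left
      field_simp
    rw [key] at h4s
    exact (div_pos_iff_of_pos_right hs0').1 h4s
  have hpos : ∀ z ∈ U, 0 < (F z).im := fun z hz ↦
    hUc.lt_of_ne (continuous_im.comp_continuousOn (hF.mono hUE).continuousOn) hne hwit hz
  -- points of `E` mapped into the upper half-plane lie in `U`
  have hback : ∀ z ∈ E, 0 < (F z).im → z ∈ U := by
    intro z hz hFz
    rcases lt_trichotomy z.im 0 with him | him | him
    · have hcz : conj z ∈ E ∩ upperHalfPlaneSet :=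
        ⟨hsymm hz, show 0 < (conj z).im by rw [conj_im]; linarith⟩
      have h1 := hpos _ (hEH hcz)
      rw [hFsymm z hz, conj_im] at h1
      linarith
    · have h1 : F z = conj (F z) := by
        conv_lhs => rw [← conj_eq_iff_im.2 him]
        exact hFsymm z hz
      have h2 : (F z).im = 0 := conj_eq_iff_im.1 h1.symm
      linarith
    · exact hEH ⟨hz, him⟩
  have hbijU : BijOn F U (ball 0 1 ∩ upperHalfPlaneSet) := by
    refine ⟨fun z hz ↦ ⟨hbij.mapsTo (hUE hz), hpos z hz⟩, hbij.injOn.mono hUE, fun w hw ↦ ?_⟩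
    obtain ⟨z, hz, rfl⟩ := hbij.surjOn hw.1
    exact ⟨z, hback z hz hw.2, rfl⟩
  -- the two inverse functions agree on the half-disc
  have hinvEq : EqOn (invFunOn F U) (invFunOn F E) (ball 0 1 ∩ upperHalfPlaneSet) := by
    intro w hw
    have hU' : ∃ a ∈ U, F a = w := hbijU.surjOn hw
    have hE'' : ∃ a ∈ E, F a = w := hbij.surjOn hw.1
    apply hbij.injOn (hUE (invFunOn_mem hU')) (invFunOn_mem hE'')
    rw [invFunOn_eq hU', invFunOn_eq hE'']
  have hinvU : DifferentiableOn ℂ (invFunOn F U) (ball 0 1 ∩ upperHalfPlaneSet) :=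
    (hFinv.mono inter_subset_left).congr hinvEq
  -- `F` is real on the real segment
  have hFreal : ∀ t : ℝ, (t : ℂ) ∈ B → (F t).im = 0 := by
    intro t ht
    have h1 : F (conj (t : ℂ)) = conj (F t) := hFsymm _ (hBE ht)
    rw [conj_ofReal] at h1
    -- `h1 : F t = conj (F t)`
    exact conj_eq_iff_im.1 h1.symm
  -- `F` is strictly increasing on the real segment
  have hseg : ∀ t : ℝ, t ∈ Ioo (x - r) (x + r) → (t : ℂ) ∈ B := by
    intro t ht
    rw [hB_def, Metric.mem_ball, dist_eq_norm, ← ofReal_sub, norm_real, Real.norm_eq_abs, abs_lt]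
    constructor <;> linarith [ht.1, ht.2]
  have hcontRe : ContinuousOn (fun t : ℝ => (F t).re) (Ioo (x - r) (x + r)) := by
    have h1 : ContinuousOn F E := hF.continuousOn
    have h2 : ContinuousOn (fun t : ℝ => F t) (Ioo (x - r) (x + r)) :=
      h1.comp continuous_ofReal.continuousOn fun t ht => hBE (hseg t ht)
    exact continuous_re.comp_continuousOn h2
  have hinjRe : InjOn (fun t : ℝ => (F t).re) (Ioo (x - r) (x + r)) := by
    intro s hs t ht hst
    have h1 : F s = F t := by
      apply Complex.ext hst
      rw [hFreal s (hseg s hs), hFreal t (hseg t ht)]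
    have h2 := hbij.injOn (hBE (hseg s hs)) (hBE (hseg t ht)) h1
    exact ofReal_inj.1 h2
  have hxr : x - r < x + r := by linarith
  have hmono : StrictMonoOn (fun t : ℝ => (F t).re) (Ioo (x - r) (x + r)) := by
    rcases hcontRe.strictMonoOn_of_injOn_Ioo hxr hinjRe with h | h
    · exact h
    · exfalso
      -- a strictly decreasing `Re F` contradicts `F'(x) = c > 0` along the real axis
      have h2 : Tendsto (fun s : ℝ ↦ (s : ℂ)) (𝓝[>] 0) (𝓝[≠] 0) := by
        refine tendsto_nhdsWithin_of_tendsto_nhds_of_eventually_within _ ?_ ?_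
        · simpa using (continuous_ofReal.tendsto 0).mono_left nhdsWithin_le_nhds
        · filter_upwards [self_mem_nhdsWithin] with s hs
          exact ofReal_ne_zero.2 (ne_of_gt hs)
      have h3 := (continuous_re.tendsto _).comp (hslope.comp h2)
      simp only [ofReal_re] at h3
      have h4 : ∀ᶠ s : ℝ in 𝓝[>] 0, 0 < (((s : ℂ))⁻¹ • (F (x + (s : ℂ)) - F x)).re :=
        h3.eventually (lt_mem_nhds hc)
      have h5 : ∀ᶠ s : ℝ in 𝓝[>] 0, s < r := by
        have : Iio r ∈ 𝓝 (0 : ℝ) := Iio_mem_nhds hr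
        exact mem_nhdsWithin_of_mem_nhds this
      obtain ⟨s, ⟨h4s, h5s⟩, hs0⟩ := ((h4.and h5).and self_mem_nhdsWithin).exists
      have hs0' : (0 : ℝ) < s := hs0
      rw [hF0, sub_zero, smul_eq_mul, ← ofReal_inv, ← ofReal_add, re_ofReal_mul] at h4s
      have h6 : 0 < (F ((x + s : ℝ) : ℂ)).re := by
        have := (mul_pos_iff_of_pos_left (inv_pos.2 hs0')).1 h4s
        exact this
      have hxI : x ∈ Ioo (x - r) (x + r) := ⟨by linarith, by linarith⟩
      have hxsI : x + s ∈ Ioo (x - r) (x + r) := ⟨by linarith, by linarith⟩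
      have h7 := h hxI hxsI (by linarith)
      -- `h7 : (F (x + s)).re < (F x).re = 0`
      simp only [hF0, zero_re] at h7
      linarith
  exact ⟨E, F, hEo, hUE, hBE, hF, hbij, hbijU, hFinv, hinvEq, hinvU, hF0, ⟨c, hc, hFd⟩, hFreal,
    hmono⟩

end Summit.CriticalPhenomena.CardyFormulaZ2.Theorems.StretchedPullback
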